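import Summits.CriticalPhenomena.SAWScalingLimit.Theorems.SAWDefectDecoherenceBoundaryClosureRIdentificationOfGateTrace
import Summits.CriticalPhenomena.SAWScalingLimit.Theorems.SAWDefectDecoherenceBoundaryClosureRPickEngineStage2

/-!
# `BoundaryClosureR`, line `pick-half-plane`, stub `stub_gateTrace`: reduction of the gate trace
# to the frame regularity (classical, landed) and ONE boundary-value law (model input)

Helpers of the stub `stub_gateTrace : GateTrace` (crux stmt-CriticalPhenomena-14004, route
`SAWDefectDecoherence`, line `pick-half-plane`): the registered pointwise core
`gateTrace_of_boundaryValues` and its global form `gateTrace_of_boundaryValueLaw`.  The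
skeleton's `GateTrace` (ONE universal `c ≠ 0` with `g · exp(−(5/8)(L − L_b)) → c` within the
carrier at EVERY point of the flat gate, for every Pick–cup weak limit `g` of the target's root
and every admissible conformal datum `(Φ, L, L_b)`) splits into

* (a) `GateFrameRegular` — the CLASSICAL regularity of the conformal frame along the open gate:
  `L` has a finite limit within the carrier at every gate point `y ≠ D.pt 0` (this is the landed
  theorem `gateTrace_frameRegular` of `…GateFrameRegular.lean`, stated here verbatim as the first
  hypothesis), and
* (b) `GateBoundaryValueLaw` — the MODEL content (Conjecture-2 strength, the sibling line's
  boundary arrival profile in Pick form): with ONE universal `c ≠ 0`, at every gate point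
  `y ≠ D.pt 0` the boundary value `w` of `g` (it exists and is non-zero by clause 3 of
  `IsPickCupLimit`) and the boundary value `L(y)` of the frame satisfy
  `w · exp(−(5/8)(L(y) − L_b)) = c`, i.e. the gate values of every Pick–cup weak limit ARE
  `c · (Φ'(y)/Φ'(b))^{5/8}`;

and `gateTrace_of_boundaryValueLaw : GateFrameRegular → GateBoundaryValueLaw → GateTrace` (all
three UNFOLDED verbatim in the skeleton's vocabulary, nothing new defined).  Proof: at gate points
`y ≠ pt 0` the product of the two limits is `c`; the root is kept off a smaller gate ball
`B(pt 1, ρ')`, `ρ' = min ρ |pt 0 − pt 1|` (`pt 0 ≠ pt 1`), on whose diameter the trace is thus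
known everywhere, so the landed core `identification_of_gateTrace_core` (holomorphy of `L`,
Schwarz reflection, identity theorem) gives `g = c · exp((5/8)(L − L_b))` on the whole carrier —
after which `g · exp(−(5/8)(L − L_b)) ≡ c` tends to `c` at every point, the root included (where
neither `g` nor `L` has a finite limit, so that (a) and (b) must, and `GateTrace` need not, exclude
it).
-/

noncomputable section

open scoped BigOperators ComplexConjugate Topology
open Filter Set MeasureTheory
open Literature.Probability.LatticeModels Literature.Probability.RandomPlanarGeometry
open Literature.Probability.RandomPlanarGeometry.SAW
open Summit.CriticalPhenomena.SAWScalingLimit.Theses.SAWDefectDecoherence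

namespace Summit.CriticalPhenomena.SAWScalingLimit.Theorems.PickHalfPlane.Identification

/-- **The analytic core of the reduction (registered helper `gateTrace_of_boundaryValues` of stub
`stub_gateTrace`).** For a Dobrushin domain whose carrier is the open upper half-plane above
`D.pt 1` inside `B(D.pt 1, ρ)`, a continuous branch `L` of `log Φ'` (`Φ : Ω → ℍₒ` conformal), a
constant `c` and `g` holomorphic on the carrier: IF at every gate point `y ≠ D.pt 0` the boundary
values `w` of `g` and `L_y` of `L` exist (clause 3 of `IsPickCupLimit`; `gateTrace_frameRegular`)
and satisfy `w · exp(−(5/8)(L_y − L_b)) = c` (the boundary-value law at this datum), THEN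
`g · exp(−(5/8)(L − L_b)) → c` within the carrier at EVERY gate point, the root included.
(Product of limits off the root; the root is kept off the smaller gate ball
`B(pt 1, min ρ |pt 0 − pt 1|)`, on which `identification_of_gateTrace_core` identifies
`g = c · exp((5/8)(L − L_b))` on the whole carrier, so that `g · exp(−(5/8)(L − L_b)) ≡ c`.)
[folklore] -/
theorem gateTrace_of_boundaryValues : ∀ (D : DobrushinDomain) (ρ : ℝ)
    (Φ : ConformalEquiv D.carrier UpperHalfPlane.upperHalfPlaneSet) (L : ℂ → ℂ) (Lb c : ℂ)
    (g : ℂ → ℂ), 0 < ρ →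
    D.carrier ∩ Metric.ball (D.pt 1) ρ = {z : ℂ | (D.pt 1).im < z.im} ∩ Metric.ball (D.pt 1) ρ →
    ContinuousOn L D.carrier → (∀ z ∈ D.carrier, Complex.exp (L z) = deriv Φ z) →
    DifferentiableOn ℂ g D.carrier →
    (∀ y : ℂ, y.im = (D.pt 1).im → y ∈ Metric.ball (D.pt 1) ρ → y ≠ D.pt 0 →
      ∃ w : ℂ, Tendsto g (𝓝[D.carrier] y) (𝓝 w)) →
    (∀ y : ℂ, y.im = (D.pt 1).im → y ∈ Metric.ball (D.pt 1) ρ → y ≠ D.pt 0 →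
      ∃ Ly : ℂ, Tendsto L (𝓝[D.carrier] y) (𝓝 Ly)) →
    (∀ y : ℂ, y.im = (D.pt 1).im → y ∈ Metric.ball (D.pt 1) ρ → y ≠ D.pt 0 →
      ∀ w Ly : ℂ, Tendsto g (𝓝[D.carrier] y) (𝓝 w) → Tendsto L (𝓝[D.carrier] y) (𝓝 Ly) →
        w * Complex.exp (-((5 / 8 : ℂ) * (Ly - Lb))) = c) →
    ∀ y : ℂ, y.im = (D.pt 1).im → y ∈ Metric.ball (D.pt 1) ρ →
      Tendsto (fun z => g z * Complex.exp (-((5 / 8 : ℂ) * (L z - Lb)))) (𝓝[D.carrier] y) (𝓝 c) := by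
  intro D ρ Φ L Lb c g hρ hflat hL hexpL hg hgw hA hB y _ _
  -- the trace at every gate point other than the root: product of the two boundary values
  have hgate : ∀ y' : ℂ, y'.im = (D.pt 1).im → y' ∈ Metric.ball (D.pt 1) ρ → y' ≠ D.pt 0 →
      Tendsto (fun z => g z * Complex.exp (-((5 / 8 : ℂ) * (L z - Lb)))) (𝓝[D.carrier] y')
        (𝓝 c) := by
    intro y' hy'im hy'ρ hy'0
    obtain ⟨w, hw⟩ := hgw y' hy'im hy'ρ hy'0
    obtain ⟨Ly, hLy⟩ := hA y' hy'im hy'ρ hy'0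
    rw [← hB y' hy'im hy'ρ hy'0 w Ly hw hLy]
    exact hw.mul (((hLy.sub_const Lb).const_mul (5 / 8 : ℂ)).neg).cexp
  -- keep the root off a smaller gate ball and identify `g` on the whole carrier
  have h01 : D.pt 0 ≠ D.pt 1 := fun h => absurd (D.pt_injective h) (by decide)
  set ρ' : ℝ := min ρ (dist (D.pt 0) (D.pt 1)) with hρ'
  have hρ'pos : 0 < ρ' := lt_min hρ (dist_pos.2 h01)
  have hsub : Metric.ball (D.pt 1) ρ' ⊆ Metric.ball (D.pt 1) ρ := Metric.ball_subset_ball (min_le_left _ _)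
  have hflat' : D.carrier ∩ Metric.ball (D.pt 1) ρ' =
      {z : ℂ | (D.pt 1).im < z.im} ∩ Metric.ball (D.pt 1) ρ' :=
    Engine.flat_of_subset hflat rfl hsub
  have hgate' : ∀ y' : ℂ, y'.im = (D.pt 1).im → y' ∈ Metric.ball (D.pt 1) ρ' →
      Tendsto (fun z => g z * Complex.exp (-((5 / 8 : ℂ) * (L z - Lb)))) (𝓝[D.carrier] y')
        (𝓝 c) := by
    intro y' hy'im hy'ρ'
    refine hgate y' hy'im (hsub hy'ρ') fun h => ?_
    have h1 : dist (D.pt 0) (D.pt 1) < ρ' := by rw [← h]; exact Metric.mem_ball.1 hy'ρ'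
    exact absurd (min_le_right ρ (dist (D.pt 0) (D.pt 1))) (not_le.2 h1)
  have hid := identification_of_gateTrace_core D ρ' Φ L Lb c g hρ'pos hflat' hL hexpL hg hgate'
  -- `g · exp(−(5/8)(L − L_b)) ≡ c` on the carrier, hence `→ c` at every point
  have hev : (fun z => g z * Complex.exp (-((5 / 8 : ℂ) * (L z - Lb)))) =ᶠ[𝓝[D.carrier] y]
      fun _ => c := by
    filter_upwards [self_mem_nhdsWithin] with z hz
    rw [hid z hz, mul_assoc, ← Complex.exp_add, add_neg_cancel, Complex.exp_zero, mul_one]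
  exact (tendsto_congr' hev).2 tendsto_const_nhds

/-- **`GateFrameRegular → GateBoundaryValueLaw → GateTrace` (the global form of the registered
core `gateTrace_of_boundaryValues`; helper of stub `stub_gateTrace`).** First hypothesis: the frame
regularity along the open gate (verbatim the statement of the landed `gateTrace_frameRegular`).
Second hypothesis (`GateBoundaryValueLaw`, the model input, same binders as `GateTrace`): ONE
universal `c ≠ 0` such that at every gate point `y ≠ D.pt 0`, whenever `g → w` and `L → L_y`
within the carrier, `w · exp(−(5/8)(L_y − L_b)) = c`.  Conclusion: the skeleton's `GateTrace`,
verbatim (unfolded).  Proof: product of limits off the root; shrink the gate ball off the root;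
`identification_of_gateTrace_core` makes `g · exp(−(5/8)(L − L_b))` identically `c` on the
carrier, hence convergent to `c` at every gate point. [folklore] -/
theorem gateTrace_of_boundaryValueLaw :
    (∀ (D : DobrushinDomain) (ρ : ℝ),
      D.carrier ∩ Metric.ball (D.pt 1) ρ = {z : ℂ | (D.pt 1).im < z.im} ∩ Metric.ball (D.pt 1) ρ →
      ∀ (Φ : ConformalEquiv D.carrier UpperHalfPlane.upperHalfPlaneSet) (L : ℂ → ℂ),
        Tendsto (fun z => ‖Φ z‖) (𝓝[D.carrier] (D.pt 0)) atTop →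
        ContinuousOn L D.carrier → (∀ z ∈ D.carrier, Complex.exp (L z) = deriv Φ z) →
      ∀ y : ℂ, y.im = (D.pt 1).im → y ∈ Metric.ball (D.pt 1) ρ → y ≠ D.pt 0 →
        ∃ Ly : ℂ, Tendsto L (𝓝[D.carrier] y) (𝓝 Ly)) →
    (∃ c : ℂ, c ≠ 0 ∧
    ∀ (D : DobrushinDomain) (ρ : ℝ) (Λ : ℝ → Finset HexVertex) (m : ℝ → ℤ) (b : ℝ → Sym2 HexVertex),
      (0 < ρ ∧
        D.carrier ∩ Metric.ball (D.pt 1) ρ = {z : ℂ | (D.pt 1).im < z.im} ∩ Metric.ball (D.pt 1) ρ ∧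
        (∀ᶠ δ : ℝ in 𝓝[>] 0, hexDomainSimplyConnected (Λ δ) ∧ b δ ∈ hexDomainBoundary (Λ δ) ∧
            (hexGraph.induce ((Λ δ : Finset HexVertex) : Set HexVertex)).Preconnected ∧
            (∀ v ∈ Λ δ, (δ : ℂ) * hexCenter v ∈ D.carrier) ∧
            (∀ v : HexVertex, (δ : ℂ) * hexCenter v ∈ Metric.ball (D.pt 1) ρ →
              (v ∈ Λ δ ↔ m δ ≤ v.1 1))) ∧
        (∀ K : Set ℂ, IsCompact K → K ⊆ D.carrier →
            ∀ᶠ δ : ℝ in 𝓝[>] 0, ∀ v : HexVertex, (δ : ℂ) * hexCenter v ∈ K → v ∈ Λ δ) ∧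
        Tendsto (fun δ : ℝ => (δ : ℂ) * hexMidpoint (b δ)) (𝓝[>] 0) (𝓝 (D.pt 1))) →
    ∀ (a : ℝ → Sym2 HexVertex) (r₀ : ℝ) (m₀ : ℝ → ℤ),
      (0 < r₀ ∧
        D.carrier ∩ Metric.ball (D.pt 0) r₀ = {z : ℂ | (D.pt 0).im < z.im} ∩ Metric.ball (D.pt 0) r₀ ∧
        (∀ᶠ δ : ℝ in 𝓝[>] 0, a δ ∈ hexDomainBoundary (Λ δ) ∧
            Nonempty (HexMidEdgeSAW (Λ δ) (a δ) (b δ)) ∧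
            (∀ v : HexVertex, (δ : ℂ) * hexCenter v ∈ Metric.ball (D.pt 0) r₀ →
              (v ∈ Λ δ ↔ m₀ δ ≤ v.1 1))) ∧
        Tendsto (fun δ : ℝ => (δ : ℂ) * hexMidpoint (a δ)) (𝓝[>] 0) (𝓝 (D.pt 0))) →
    ∀ (Φ : ConformalEquiv D.carrier UpperHalfPlane.upperHalfPlaneSet) (L : ℂ → ℂ) (Lb : ℂ),
      Tendsto (fun z => ‖Φ z‖) (𝓝[D.carrier] (D.pt 0)) atTop → Φ.HasBoundaryValue (D.pt 1) 0 →
      ContinuousOn L D.carrier → (∀ z ∈ D.carrier, Complex.exp (L z) = deriv Φ z) →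
      Tendsto L (𝓝[D.carrier] (D.pt 1)) (𝓝 Lb) →
    ∀ ns : ℕ → ℝ, Tendsto ns atTop (𝓝[>] 0) →
    ∀ g : ℂ → ℂ,
      (DifferentiableOn ℂ g D.carrier ∧
        (∃ κ : ℂ, κ ≠ 0 ∧
          Tendsto (fun z => g z * (z - D.pt 0) ^ ((5 : ℂ) / 4)) (𝓝[D.carrier] (D.pt 0)) (𝓝 κ)) ∧
        (∀ y ∈ ({z : ℂ | z.im = (D.pt 1).im} ∩ Metric.ball (D.pt 1) ρ) ∪
            ({z : ℂ | z.im = (D.pt 0).im} ∩ Metric.ball (D.pt 0) r₀),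
          y ≠ D.pt 0 → ∃ w : ℂ, w ≠ 0 ∧ Tendsto g (𝓝[D.carrier] y) (𝓝 w))) →
      (∀ ψ : ℂ → ℂ, (Continuous ψ ∧ HasCompactSupport ψ ∧ tsupport ψ ⊆ D.carrier) →
        Tendsto (fun n => ((ns n : ℝ) : ℂ) ^ 2 * (∑ᶠ z ∈ hexDomainMidEdges (Λ (ns n)),
            ψ (((ns n : ℝ) : ℂ) * hexMidpoint z) *
              hexParafermionicObservable (Λ (ns n)) (a (ns n)) hexCriticalFugacity (5 / 8) z) /
          hexParafermionicObservable (Λ (ns n)) (a (ns n)) hexCriticalFugacity (5 / 8) (b (ns n)))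
          atTop (𝓝 (∫ z, ψ z * g z))) →
      ∀ y : ℂ, y.im = (D.pt 1).im → y ∈ Metric.ball (D.pt 1) ρ → y ≠ D.pt 0 →
      ∀ w Ly : ℂ, Tendsto g (𝓝[D.carrier] y) (𝓝 w) → Tendsto L (𝓝[D.carrier] y) (𝓝 Ly) →
        w * Complex.exp (-((5 / 8 : ℂ) * (Ly - Lb))) = c) →
    ∃ c : ℂ, c ≠ 0 ∧
    ∀ (D : DobrushinDomain) (ρ : ℝ) (Λ : ℝ → Finset HexVertex) (m : ℝ → ℤ) (b : ℝ → Sym2 HexVertex),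
      (0 < ρ ∧
        D.carrier ∩ Metric.ball (D.pt 1) ρ = {z : ℂ | (D.pt 1).im < z.im} ∩ Metric.ball (D.pt 1) ρ ∧
        (∀ᶠ δ : ℝ in 𝓝[>] 0, hexDomainSimplyConnected (Λ δ) ∧ b δ ∈ hexDomainBoundary (Λ δ) ∧
            (hexGraph.induce ((Λ δ : Finset HexVertex) : Set HexVertex)).Preconnected ∧
            (∀ v ∈ Λ δ, (δ : ℂ) * hexCenter v ∈ D.carrier) ∧
            (∀ v : HexVertex, (δ : ℂ) * hexCenter v ∈ Metric.ball (D.pt 1) ρ →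
              (v ∈ Λ δ ↔ m δ ≤ v.1 1))) ∧
        (∀ K : Set ℂ, IsCompact K → K ⊆ D.carrier →
            ∀ᶠ δ : ℝ in 𝓝[>] 0, ∀ v : HexVertex, (δ : ℂ) * hexCenter v ∈ K → v ∈ Λ δ) ∧
        Tendsto (fun δ : ℝ => (δ : ℂ) * hexMidpoint (b δ)) (𝓝[>] 0) (𝓝 (D.pt 1))) →
    ∀ (a : ℝ → Sym2 HexVertex) (r₀ : ℝ) (m₀ : ℝ → ℤ),
      (0 < r₀ ∧
        D.carrier ∩ Metric.ball (D.pt 0) r₀ = {z : ℂ | (D.pt 0).im < z.im} ∩ Metric.ball (D.pt 0) r₀ ∧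
        (∀ᶠ δ : ℝ in 𝓝[>] 0, a δ ∈ hexDomainBoundary (Λ δ) ∧
            Nonempty (HexMidEdgeSAW (Λ δ) (a δ) (b δ)) ∧
            (∀ v : HexVertex, (δ : ℂ) * hexCenter v ∈ Metric.ball (D.pt 0) r₀ →
              (v ∈ Λ δ ↔ m₀ δ ≤ v.1 1))) ∧
        Tendsto (fun δ : ℝ => (δ : ℂ) * hexMidpoint (a δ)) (𝓝[>] 0) (𝓝 (D.pt 0))) →
    ∀ (Φ : ConformalEquiv D.carrier UpperHalfPlane.upperHalfPlaneSet) (L : ℂ → ℂ) (Lb : ℂ),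
      Tendsto (fun z => ‖Φ z‖) (𝓝[D.carrier] (D.pt 0)) atTop → Φ.HasBoundaryValue (D.pt 1) 0 →
      ContinuousOn L D.carrier → (∀ z ∈ D.carrier, Complex.exp (L z) = deriv Φ z) →
      Tendsto L (𝓝[D.carrier] (D.pt 1)) (𝓝 Lb) →
    ∀ ns : ℕ → ℝ, Tendsto ns atTop (𝓝[>] 0) →
    ∀ g : ℂ → ℂ,
      (DifferentiableOn ℂ g D.carrier ∧
        (∃ κ : ℂ, κ ≠ 0 ∧
          Tendsto (fun z => g z * (z - D.pt 0) ^ ((5 : ℂ) / 4)) (𝓝[D.carrier] (D.pt 0)) (𝓝 κ)) ∧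
        (∀ y ∈ ({z : ℂ | z.im = (D.pt 1).im} ∩ Metric.ball (D.pt 1) ρ) ∪
            ({z : ℂ | z.im = (D.pt 0).im} ∩ Metric.ball (D.pt 0) r₀),
          y ≠ D.pt 0 → ∃ w : ℂ, w ≠ 0 ∧ Tendsto g (𝓝[D.carrier] y) (𝓝 w))) →
      (∀ ψ : ℂ → ℂ, (Continuous ψ ∧ HasCompactSupport ψ ∧ tsupport ψ ⊆ D.carrier) →
        Tendsto (fun n => ((ns n : ℝ) : ℂ) ^ 2 * (∑ᶠ z ∈ hexDomainMidEdges (Λ (ns n)),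
            ψ (((ns n : ℝ) : ℂ) * hexMidpoint z) *
              hexParafermionicObservable (Λ (ns n)) (a (ns n)) hexCriticalFugacity (5 / 8) z) /
          hexParafermionicObservable (Λ (ns n)) (a (ns n)) hexCriticalFugacity (5 / 8) (b (ns n)))
          atTop (𝓝 (∫ z, ψ z * g z))) →
      ∀ y : ℂ, y.im = (D.pt 1).im → y ∈ Metric.ball (D.pt 1) ρ →
        Tendsto (fun z => g z * Complex.exp (-((5 / 8 : ℂ) * (L z - Lb)))) (𝓝[D.carrier] y) (𝓝 c) := by
  rintro hA ⟨c, hc, hB⟩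
  refine ⟨c, hc, ?_⟩
  intro D ρ Λ m b hAF a r₀ m₀ hPR Φ L Lb hΦ hΦb hL hexpL hLb ns hns g hg hw
  exact gateTrace_of_boundaryValues D ρ Φ L Lb c g hAF.1 hAF.2.1 hL hexpL hg.1
    (fun y hy hy' hy0 => (hg.2.2 y (Or.inl ⟨hy, hy'⟩) hy0).imp fun w h => h.2)
    (hA D ρ hAF.2.1 Φ L hΦ hL hexpL)
    (hB D ρ Λ m b hAF a r₀ m₀ hPR Φ L Lb hΦ hΦb hL hexpL hLb ns hns g hg hw)

end Summit.CriticalPhenomena.SAWScalingLimit.Theorems.PickHalfPlane.Identification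

end
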